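import Summits.QuantumFields.YangMills.Theorems.LuscherReductionTwistedTraceScalingSoftTubeOn
import Summits.QuantumFields.YangMills.Theorems.FemtoCutoffLadderFixedLatticeLawInnerRateCopies
import Summits.QuantumFields.YangMills.Theorems.FemtoCutoffLadderFixedLatticeLawValleyGain
import Summits.QuantumFields.YangMills.Theorems.FlatTubeReductionNearFlatOfBORate
import HarnessLib

/-!
# The RATE-GRADE tube package in lane A's support-separated currency, and its kernel-checked chain to K1 `NearFlatRatioLaw` and to FCL 23943
# (route `FlatTubeReduction`, crux K1 stmt-QuantumFields-24720; seat `ym-line-ftr-p1` g9; the RATE TWIN of RED lane A's C4-CORE; R2b1 RECORD rung — no summit)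

RED lane A (seat ym-luscher-20007-p1, COARSE-DESIGN §24) closes its C4-CORE through the SUPPORT-SEPARATED TUBE PACKAGE `SoftTubeBOPackageOn L χ S` (first order:
tolerance `e^{±ελ_b}` for every `ε > 0`, off-diagonal `b² ≤ εθλ_b/16`) and the landed chain `softTubeNoIntruderOn_of_package` (Feshbach endgame) →
`innerNoIntruderOneOrbitAt_of_softTubeOn` (slice identities) → the eight copies.  The registered stub of THIS crux, `stub_boRate : BORateAll` (= FCL 23943's), asks for the
same Born–Oppenheimer data AT RATE GRADE (tolerance `e^{±Cλ_b²}`), typed in the older lattice currency of the FCL door `oneOrbitRate_of_bo` ((P1)(P3)(P4)(P5)(P6) + floor).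
This file types the rate twin DIRECTLY IN LANE A's TUBE CURRENCY and lands its whole assembly chain, so that the pooled rate-twin seat owes exactly lane A's analytic bricks
((F)(ST)(OD)(N), adapted fibres) at rate grade and nothing else:
* `RateTube.SoftTubeNoIntruderRateOn L χ S` — lane A's `SoftTubeNoIntruderOn` with `e^{ελ_b}` replaced by `e^{Cλ_b²}` (`∀ k, ∃ C β₀, …`);
* `RateTube.SoftTubeBORatePackageOn L χ S` — lane A's `SoftTubeBOPackageOn` with `∀ ε ∃ θ` replaced by `∃ C θ`: off-diagonal `b² ≤ Cλ_b²θ/16`, FLOOR `e^{−Cλ_b²/4}σμ₀ ≤ λ₀`,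
  MASS, STIFF `(1−θ)σμ₀`, SPLIT, SLOW `T(u_a) ≤ e^{Cλ_b²/4}σμ_k‖u_a‖²_w`;
* ★★★ `RateTube.softTubeNoIntruderRateOn_of_ratePackage` — the Feshbach endgame at rate grade (lane A's `feshbach_endgame` VERBATIM with `ε := Cλ_b`);
* ★★★ `RateTube.oneOrbitRate_of_softTubeRateOn` — the slice identities (lane A's `innerNoIntruderOneOrbitAt_of_softTubeOn` verbatim) give the one-orbit INNER RATE in lattice
  currency = the hypothesis `hI1` of FCL's `innerRate_of_oneOrbitRate`;
* ★★★ `RateTube.innerRateAt_of_ratePackage` (eight copies), ★★★★ `RateTube.nearFlatRatioLaw_of_ratePackage` (K1 24720 via `nearFlatRatioLaw_of_innerRate`, `δ = β^{−1/40}`),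
  ★★★★ `RateTube.femtoGapFixedLattice_of_ratePackage` (FCL 23943 ≡ `FemtoGapFixedLattice` via `valleyGainAt_ledger` + `femtoGapFixedLatticeAt_of_valley_innerRate`; `L = 1` = crux ONE),
  and the record-weight instances `…_of_bigRecordWeight_ratePackage` (`χ_big = recordWeightRho (3δ) (Mδ) δg`, `M ≥ 6`, test support `{orbitDist < δ}`, `δ = β^{−1/40}`).
So the crux K1 (and FCL 23943) ⇐ ONE typed statement: `∀ L ≥ 2, SoftTubeBORatePackageOn L (recordWeightRho L (3β^{−1/40}) (Mβ^{−1/40}) δg) {orbitDist < β^{−1/40}}` — the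
rate twin of lane A's `BOBricks → SoftTubeBOPackageOn` (p648135 ff.), whose FLOOR one-site input is `Quasimode.exists_concentrated_quasimode_levelValue` (p647846).
HONEST FRAMING: typed reductions and endgame algebra (bookkeeping over lane A's and FCL's landed doors); the rate-grade package itself is OPEN fixed-lattice semiclassics on
`SU(2)^{3L³}`; femto rung R2b1 (RECORD label); not infinite volume, not a mass gap, not Clay.  Two new `def`s (target texts), no named facts, no `sorry`.
-/

set_option autoImplicit false

noncomputable section

open MeasureTheory Filter Topology Real
open scoped BigOperators
open Literature.MathematicalPhysics.QuantumFieldTheory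
open Literature.MathematicalPhysics.QuantumLattice

namespace Summit.QuantumFields.YangMills.Theorems.FemtoTransferGap

namespace RateTube

open TwoLattice.Avg TwoLattice.ConstTube
open Summit.QuantumFields.YangMills.Theorems.FemtoCutoffLadder

variable {L : ℕ} [NeZero L]

/-! ## §1 The rate-grade targets in tube currency -/

variable (L) in
/-- **SOFT TUBE NO-INTRUDER WITH RATE, separated support** (target text; OPEN): for every level `k` there are `C, β₀` such that for `β ≥ β₀` every `(k+1)`-family of bounded
measurable tube functions supported in `supp (χ β) ∩ S β` with nondegenerate weighted Gram matrix has a nonzero combination `f_a` with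
`(∫∫ f_a K̃_β f_a)·μ₀(L³β) ≤ e^{C·λ_b(L³β)²}·μ_k(L³β)·λ₀(β,L)·‖f_a‖²_w` — lane A's `SoftTubeNoIntruderOn` at rate grade. [cite: Luscher1983, §3] -/
def SoftTubeNoIntruderRateOn (χ : ℝ → GaugeConfig 3 L SU2 → ℝ) (S : ℝ → Set (GaugeConfig 3 L SU2)) : Prop :=
  ∀ k : ℕ, ∃ C β0 : ℝ, ∀ β : ℝ, β0 ≤ β →
    ∀ f : Fin (k + 1) → (GaugeConfig 3 L SU2 → ℝ),
      (∀ i, Measurable (f i)) → (∀ i, ∃ C' : ℝ, ∀ U, |f i U| ≤ C') → (∀ i U, f i U ≠ 0 → χ β U ≠ 0) → (∀ i U, f i U ≠ 0 → U ∈ S β) →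
      (∀ a : Fin (k + 1) → ℝ, a ≠ 0 → 0 < ∫ U, (∑ i, a i * f i U) ^ 2 * softWeight (χ β) U ∂configMeasure SU2 L) →
        ∃ a : Fin (k + 1) → ℝ, a ≠ 0 ∧
          (∫ U, ∫ V, (∑ i, a i * f i U) * avgKernel β U V * (∑ i, a i * f i V) ∂configMeasure SU2 L ∂configMeasure SU2 L) *
              levelValue su2Rep 1 ((L : ℝ) ^ 3 * β) 0 ≤
            Real.exp (C * bareLambda ((L : ℝ) ^ 3 * β) ^ 2) * levelValue su2Rep 1 ((L : ℝ) ^ 3 * β) k * levelValue su2Rep L β 0 *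
              ∫ U, (∑ i, a i * f i U) ^ 2 * softWeight (χ β) U ∂configMeasure SU2 L

variable (L) in
/-- **THE BORN–OPPENHEIMER TUBE PACKAGE WITH RATE, separated support** (target text; OPEN — the RATE TWIN of lane A's `SoftTubeBOPackageOn`): for every level `k` there are
`C ≥ 0`, a stiff gap `θ ∈ (0,1]` and `β₀` such that for `β ≥ β₀` there are `σ > 0` (fibre energy factor) and `b ≥ 0` with OFF-DIAGONAL SIZE `b² ≤ C·λ_b²·θ/16`
(`λ_b = bareLambda (L³β)`), the FLOOR WITH RATE `e^{−Cλ_b²/4}·σ·μ₀(L³β) ≤ λ₀(β,L)`, and for every admissible family `f` (bounded measurable, supported in `supp χ ∩ S`,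
nondegenerate) a split `f = u + v` into families with: MASS `‖u_a‖²_w + ‖v_a‖²_w ≤ ‖f_a‖²_w`, STIFF `T(v_a) ≤ (1−θ)σμ₀‖v_a‖²_w`, SPLIT
`T(f_a) ≤ T(u_a) + 2bσμ₀‖u_a‖_w‖v_a‖_w + T(v_a)` for all `a`, and SLOW WITH RATE `∃ a ≠ 0, T(u_a) ≤ e^{Cλ_b²/4}·σ·μ_k(L³β)·‖u_a‖²_w`.
[cite: Luscher1983, §3] [cite: SjostrandZworski2007, §2] [cite: GustafsonSigal2003, §11–§12] -/
def SoftTubeBORatePackageOn (χ : ℝ → GaugeConfig 3 L SU2 → ℝ) (S : ℝ → Set (GaugeConfig 3 L SU2)) : Prop :=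
  ∀ k : ℕ, ∃ C θ : ℝ, 0 ≤ C ∧ 0 < θ ∧ θ ≤ 1 ∧ ∃ β0 : ℝ, ∀ β : ℝ, β0 ≤ β →
    ∃ σ b : ℝ, 0 < σ ∧ 0 ≤ b ∧ b ^ 2 ≤ C * bareLambda ((L : ℝ) ^ 3 * β) ^ 2 * θ / 16 ∧
      Real.exp (-(C * bareLambda ((L : ℝ) ^ 3 * β) ^ 2 / 4)) * (σ * levelValue su2Rep 1 ((L : ℝ) ^ 3 * β) 0) ≤ levelValue su2Rep L β 0 ∧
      ∀ f : Fin (k + 1) → (GaugeConfig 3 L SU2 → ℝ),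
        (∀ i, Measurable (f i)) → (∀ i, ∃ C' : ℝ, ∀ U, |f i U| ≤ C') → (∀ i U, f i U ≠ 0 → χ β U ≠ 0) → (∀ i U, f i U ≠ 0 → U ∈ S β) →
        (∀ a : Fin (k + 1) → ℝ, a ≠ 0 → 0 < tubeNormSq (softWeight (χ β)) (fun U => ∑ i, a i * f i U)) →
          ∃ u v : Fin (k + 1) → (GaugeConfig 3 L SU2 → ℝ),
            (∀ a : Fin (k + 1) → ℝ,
              0 ≤ tubeNormSq (softWeight (χ β)) (fun U => ∑ i, a i * u i U) ∧
              0 ≤ tubeNormSq (softWeight (χ β)) (fun U => ∑ i, a i * v i U) ∧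
              tubeNormSq (softWeight (χ β)) (fun U => ∑ i, a i * u i U) + tubeNormSq (softWeight (χ β)) (fun U => ∑ i, a i * v i U) ≤
                tubeNormSq (softWeight (χ β)) (fun U => ∑ i, a i * f i U) ∧
              tubeForm β (fun U => ∑ i, a i * v i U) ≤
                (1 - θ) * (σ * levelValue su2Rep 1 ((L : ℝ) ^ 3 * β) 0) * tubeNormSq (softWeight (χ β)) (fun U => ∑ i, a i * v i U) ∧
              tubeForm β (fun U => ∑ i, a i * f i U) ≤
                tubeForm β (fun U => ∑ i, a i * u i U) +
                  2 * (b * (σ * levelValue su2Rep 1 ((L : ℝ) ^ 3 * β) 0)) *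
                    Real.sqrt (tubeNormSq (softWeight (χ β)) (fun U => ∑ i, a i * u i U)) *
                    Real.sqrt (tubeNormSq (softWeight (χ β)) (fun U => ∑ i, a i * v i U)) +
                  tubeForm β (fun U => ∑ i, a i * v i U)) ∧
            ∃ a : Fin (k + 1) → ℝ, a ≠ 0 ∧
              tubeForm β (fun U => ∑ i, a i * u i U) ≤
                Real.exp (C * bareLambda ((L : ℝ) ^ 3 * β) ^ 2 / 4) * (σ * levelValue su2Rep 1 ((L : ℝ) ^ 3 * β) k) *
                  tubeNormSq (softWeight (χ β)) (fun U => ∑ i, a i * u i U)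

/-- A rate statement on a larger admissible support set implies the one on a smaller set. [folklore] -/
theorem SoftTubeNoIntruderRateOn.mono {χ : ℝ → GaugeConfig 3 L SU2 → ℝ} {S S' : ℝ → Set (GaugeConfig 3 L SU2)} (hSS' : ∀ β, S β ⊆ S' β)
    (h : SoftTubeNoIntruderRateOn L χ S') : SoftTubeNoIntruderRateOn L χ S := by
  intro k
  obtain ⟨C, β0, hβ0⟩ := h k
  exact ⟨C, β0, fun β hβ f hm hb hs hS hG => hβ0 β hβ f hm hb hs (fun i U hU => hSS' β (hS i U hU)) hG⟩

/-! ## §2 ★★★ The Feshbach endgame at rate grade: package ⇒ no-intruder with rate -/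

/-- ★★★ **`SoftTubeBORatePackageOn L χ S → SoftTubeNoIntruderRateOn L χ S`**: lane A's `feshbach_endgame` with `ε := C·λ_b` (so that `ε·λ_b = C·λ_b²`), the one-site
levels from crux ONE (`μ_k ≥ μ₀/2`, `μ_k ≥ (1 − θ/2)μ₀` eventually), and the smallness `λ_b ≤ θ/(2(|Δ_k| + |C₁| + 2))`.  Proof = `softTubeNoIntruderOn_of_package` verbatim.
[cite: Luscher1983, §3] [cite: SjostrandZworski2007, §2] -/
theorem softTubeNoIntruderRateOn_of_ratePackage {χ : ℝ → GaugeConfig 3 L SU2 → ℝ} {S : ℝ → Set (GaugeConfig 3 L SU2)} (hP : SoftTubeBORatePackageOn L χ S) :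
    SoftTubeNoIntruderRateOn L χ S := by
  intro k
  have hL1 : (1 : ℝ) ≤ (L : ℝ) ^ 3 := one_le_pow₀ (by exact_mod_cast NeZero.one_le)
  obtain ⟨C1, B0, hONE⟩ := oneSiteLevels_proof k
  obtain ⟨C, θ, hC0, hθ, hθ1, βP, hPk⟩ := hP k
  set τ : ℝ := θ / (2 * (|levelGap k| + |C1| + 2)) with hτ
  have hτ0 : 0 < τ := by rw [hτ]; positivity
  refine ⟨C, max (max 1 B0) (max βP (2 / τ ^ 3)), fun β hβ => ?_⟩
  have hβ1 : 1 ≤ β := ((le_max_left _ _).trans (le_max_left _ _)).trans hβ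
  have hβ0 : 0 < β := by linarith
  have hβB0 : B0 ≤ β := ((le_max_right _ _).trans (le_max_left _ _)).trans hβ
  have hβP : βP ≤ β := ((le_max_left _ _).trans (le_max_right _ _)).trans hβ
  have hβτ : 2 / τ ^ 3 ≤ β := ((le_max_right _ _).trans (le_max_right _ _)).trans hβ
  intro f hfm hfb hfs hfS hGram
  have hB'β : β ≤ (L : ℝ) ^ 3 * β := by nlinarith
  have hB'0 : 0 < (L : ℝ) ^ 3 * β := lt_of_lt_of_le hβ0 hB'β
  obtain ⟨hμ0, -, hμk⟩ := hONE ((L : ℝ) ^ 3 * β) (hβB0.trans hB'β)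
  set lam := bareLambda ((L : ℝ) ^ 3 * β) with hlamdef
  have hlam0 : 0 < lam := bareLambda_pos' hB'0
  have hlamτ : lam ≤ τ := bareLambda_cube_le (L := L) hτ0 hβτ
  have hτle : τ ≤ 1 / (2 * (|levelGap k| + |C1| + 2)) := by
    rw [hτ]; exact div_le_div_of_nonneg_right hθ1 (by positivity)
  obtain ⟨-, -, hy⟩ := smallness_of_le hlam0.le (hlamτ.trans hτle)
  have hμk' : Real.exp (-(levelGap k * lam + |C1| * lam ^ 2)) * levelValue su2Rep 1 ((L : ℝ) ^ 3 * β) 0 ≤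
      levelValue su2Rep 1 ((L : ℝ) ^ 3 * β) k := by
    refine le_trans (mul_le_mul_of_nonneg_right (Real.exp_le_exp.2 ?_) hμ0.le) hμk
    have := mul_le_mul_of_nonneg_right (le_abs_self C1) (sq_nonneg lam)
    linarith
  have hμk2 := half_le_of_exp_lower hy hμ0.le hμk'
  have hyθ : levelGap k * lam + |C1| * lam ^ 2 ≤ θ / 2 := by
    have hlam1 : lam ≤ 1 := by
      have : τ ≤ 1 / (2 * 2) := hτle.trans (by
        apply div_le_div_of_nonneg_left (by norm_num) (by norm_num)
        nlinarith [abs_nonneg (levelGap k), abs_nonneg C1])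
      linarith
    have h1 : levelGap k * lam ≤ |levelGap k| * lam := mul_le_mul_of_nonneg_right (le_abs_self _) hlam0.le
    have h2 : |C1| * lam ^ 2 ≤ |C1| * lam := by
      refine mul_le_mul_of_nonneg_left ?_ (abs_nonneg _); nlinarith
    have h3 : (|levelGap k| + |C1|) * lam ≤ (|levelGap k| + |C1|) * τ := mul_le_mul_of_nonneg_left hlamτ (by positivity)
    have h4 : (|levelGap k| + |C1|) * τ ≤ θ / 2 := by
      rw [hτ]
      have hpos : 0 < 2 * (|levelGap k| + |C1| + 2) := by positivity
      rw [mul_div_assoc', div_le_iff₀ hpos]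
      nlinarith [abs_nonneg (levelGap k), abs_nonneg C1]
    linarith
  have hμkθ : (1 - θ / 2) * levelValue su2Rep 1 ((L : ℝ) ^ 3 * β) 0 ≤ levelValue su2Rep 1 ((L : ℝ) ^ 3 * β) k := by
    refine le_trans (mul_le_mul_of_nonneg_right ?_ hμ0.le) hμk'
    have := Real.add_one_le_exp (-(levelGap k * lam + |C1| * lam ^ 2))
    linarith
  obtain ⟨σ, b, hσ, -, hb2, hfloor, hsplit⟩ := hPk β hβP
  obtain ⟨u, v, hall, a, ha, huu⟩ := hsplit f hfm hfb hfs hfS hGram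
  obtain ⟨hNu, hNv, hN, hvv, hQ⟩ := hall a
  refine ⟨a, ha, ?_⟩
  -- `ε := C·λ_b`
  have hb2' : b ^ 2 ≤ C * lam * θ * lam / 16 := by
    have e : C * lam * θ * lam / 16 = C * lam ^ 2 * θ / 16 := by ring
    rw [e]; exact hb2
  have hfloor' : Real.exp (-(C * lam / 4 * lam)) * (σ * levelValue su2Rep 1 ((L : ℝ) ^ 3 * β) 0) ≤ levelValue su2Rep L β 0 := by
    have e : C * lam / 4 * lam = C * lam ^ 2 / 4 := by ring
    rw [e]; exact hfloor
  have huu' : tubeForm β (fun U => ∑ i, a i * u i U) ≤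
      Real.exp (C * lam / 4 * lam) * (σ * levelValue su2Rep 1 ((L : ℝ) ^ 3 * β) k) * tubeNormSq (softWeight (χ β)) (fun U => ∑ i, a i * u i U) := by
    have e : C * lam / 4 * lam = C * lam ^ 2 / 4 := by ring
    rw [e]; exact huu
  have key := feshbach_endgame (ε := C * lam) (by positivity) hlam0.le hσ.le hθ hμ0.le hμk2 hμkθ hNu hNv hN hb2' hfloor' hvv hQ huu'
  have e : C * lam * lam = C * lam ^ 2 := by ring
  rw [e] at key
  exact key

/-! ## §3 ★★★ The one-orbit INNER RATE in lattice currency from the rate-grade tube statement (slice identities, verbatim) -/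

/-- ★★★ **ONE-ORBIT INNER RATE ⇐ the rate-grade soft tube statement for test functions supported in `{orbitDist < δ}`** (weight admissible at radius `δ`): for every level
`k`, the hypothesis `hI1` of FCL's `innerRate_of_oneOrbitRate k` — every bounded measurable gauge-invariant `(k+1)`-family supported in `{orbitDist < δ(β)}` with nondegenerate
Gram matrix has a nonzero combination with `⟨G_a,K_βG_a⟩·μ₀ ≤ e^{Cλ_b²}·μ_k·λ₀·‖G_a‖²`.  Proof = lane A's `innerNoIntruderOneOrbitAt_of_softTubeOn` verbatim (the slice
function `f = Gχ/N` is supported where `G` is; `qform_eq_integral_avgKernel`, `l2_eq_sliceFn_left`). [cite: Luscher1983, §3] -/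
theorem oneOrbitRate_of_softTubeRateOn {δ : ℝ → ℝ} {χ : ℝ → GaugeConfig 3 L SU2 → ℝ} (hT : SoftTubeAdmissible L δ χ)
    (hN : SoftTubeNoIntruderRateOn L χ (fun β => {U | orbitDist U < δ β})) (k : ℕ) :
    ∃ C₁ βI : ℝ, ∀ β : ℝ, βI ≤ β →
      ∀ G : Fin (k + 1) → (GaugeConfig 3 L SU2 → ℝ),
        (∀ i, Measurable (G i)) → (∀ i, ∃ C : ℝ, ∀ U, |G i U| ≤ C) →
        (∀ i (g : Site 3 L → SU2) (U : GaugeConfig 3 L SU2), G i (gaugeTransform g U) = G i U) →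
        (∀ i U, G i U ≠ 0 → orbitDist U < δ β) →
        (∀ a : Fin (k + 1) → ℝ, a ≠ 0 → 0 < l2 (fun U => ∑ i, a i * G i U) (fun U => ∑ i, a i * G i U)) →
          ∃ a : Fin (k + 1) → ℝ, a ≠ 0 ∧
            qform su2Rep β (fun U => ∑ i, a i * G i U) (fun U => ∑ i, a i * G i U) * levelValue su2Rep 1 ((L : ℝ) ^ 3 * β) 0 ≤
              Real.exp (C₁ * bareLambda ((L : ℝ) ^ 3 * β) ^ 2) * levelValue su2Rep 1 ((L : ℝ) ^ 3 * β) k * levelValue su2Rep L β 0 *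
                l2 (fun U => ∑ i, a i * G i U) (fun U => ∑ i, a i * G i U) := by
  obtain ⟨hχm, hχb, β1, hβ1⟩ := hT
  obtain ⟨C, β0, hβ0⟩ := hN k
  refine ⟨C, max β0 β1, fun β hβ G hGm hGb hGinv hGsupp hGind => ?_⟩
  have hβ0' : β0 ≤ β := (le_max_left _ _).trans hβ
  obtain ⟨hcov, n₀, hn₀, hNlow⟩ := hβ1 β ((le_max_right _ _).trans hβ)
  obtain ⟨Cχ, hCχ⟩ := hχb β
  set f : Fin (k + 1) → GaugeConfig 3 L SU2 → ℝ := fun i => sliceFn (χ β) (G i) with hf_def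
  have hψ : ∀ a : Fin (k + 1) → ℝ,
      Measurable (fun U => ∑ i, a i * G i U) ∧ (∃ C : ℝ, ∀ U, |∑ i, a i * G i U| ≤ C) ∧
        (∀ (g : Site 3 L → SU2) (U : GaugeConfig 3 L SU2), (∑ i, a i * G i (gaugeTransform g U)) = ∑ i, a i * G i U) ∧
        (∀ U, (∑ i, a i * G i U) ≠ 0 → gaugeAvg (χ β) U ≠ 0) := fun a =>
    ⟨measurable_combination hGm a, bounded_combination hGb a, invariant_combination hGinv a, fun U hU => by
      obtain ⟨i, hi⟩ := exists_ne_zero_of_combination_ne_zero hU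
      exact (hcov U (hGsupp i U hi)).ne'⟩
  have hslice : ∀ a : Fin (k + 1) → ℝ, sliceFn (χ β) (fun U => ∑ i, a i * G i U) = fun U => ∑ i, a i * f i U := fun a => sliceFn_sum (χ β) a G
  have hpack : ∀ a : Fin (k + 1) → ℝ,
      l2 (fun U => ∑ i, a i * G i U) (fun U => ∑ i, a i * G i U) = ∫ U, (∑ i, a i * f i U) ^ 2 * softWeight (χ β) U ∂configMeasure SU2 L ∧
      qform su2Rep β (fun U => ∑ i, a i * G i U) (fun U => ∑ i, a i * G i U) =
        ∫ U, ∫ V, (∑ i, a i * f i U) * avgKernel β U V * (∑ i, a i * f i V) ∂configMeasure SU2 L ∂configMeasure SU2 L := fun a => by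
    obtain ⟨hm, ⟨C', hC'⟩, hinv, hcv⟩ := hψ a
    have h1 := qform_eq_integral_avgKernel β (hχm β) hCχ hn₀ hNlow hm hC' hinv hcv hm hC' hinv hcv
    have h2 := l2_eq_sliceFn_left (hχm β) hCχ hn₀ hNlow hm hC' hinv hcv hm hC' hinv
    rw [hslice a] at h1 h2
    refine ⟨?_, h1⟩
    rw [h2]
    unfold l2
    refine integral_congr_ae (ae_of_all _ fun U => ?_)
    have h3 := sliceFn_mul_self_eq (ψ := fun U => ∑ i, a i * G i U) hn₀ hNlow U
    rw [hslice a] at h3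
    exact h3
  have hfm : ∀ i, Measurable (f i) := fun i => measurable_sliceFn (hχm β) (hGm i)
  have hfb : ∀ i, ∃ C : ℝ, ∀ U, |f i U| ≤ C := fun i => by
    obtain ⟨C', hC'⟩ := hGb i
    exact ⟨C' * Cχ / n₀, abs_sliceFn_le hCχ hC' hn₀ hNlow⟩
  have hfsupp : ∀ i U, f i U ≠ 0 → χ β U ≠ 0 := fun i U hU => (sliceFn_ne_zero hU).1
  have hfS : ∀ i U, f i U ≠ 0 → U ∈ {U : GaugeConfig 3 L SU2 | orbitDist U < δ β} := fun i U hU => hGsupp i U (sliceFn_ne_zero hU).2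
  have hfind : ∀ a : Fin (k + 1) → ℝ, a ≠ 0 → 0 < ∫ U, (∑ i, a i * f i U) ^ 2 * softWeight (χ β) U ∂configMeasure SU2 L := fun a ha => by
    rw [← (hpack a).1]; exact hGind a ha
  obtain ⟨a, ha, hle⟩ := hβ0 β hβ0' f hfm hfb hfsupp hfS hfind
  refine ⟨a, ha, ?_⟩
  rw [(hpack a).2, (hpack a).1]
  exact hle

/-! ## §4 ★★★ The eight copies, and the two cruxes -/

/-- ★★★ **INNER NO-INTRUDER WITH RATE (physical families near the eight torons) ⇐ the rate-grade tube package**, for an admissible weight at a positive scale `δ`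
eventually `≤ 1/(2L)`: compose with FCL's `innerRate_of_oneOrbitRate`. [cite: Luscher1983, §3] [cite: GustafsonSigal2003, §11–§12] -/
theorem innerRateAt_of_ratePackage (k : ℕ) {δ : ℝ → ℝ} {χ : ℝ → GaugeConfig 3 L SU2 → ℝ} (hδ : ∀ β, 0 < δ β)
    (hδL : ∃ β1 : ℝ, ∀ β : ℝ, β1 ≤ β → δ β ≤ 1 / (2 * L)) (hT : SoftTubeAdmissible L δ χ)
    (hP : SoftTubeBORatePackageOn L χ (fun β => {U | orbitDist U < δ β})) :
    ∃ C βI : ℝ, ∀ β : ℝ, βI ≤ β →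
      ∀ F : Fin (k + 1) → (GaugeConfig 3 L SU2 → ℝ), (∀ i, IsPhys (F i)) →
        (∀ i U, F i U ≠ 0 → ∃ z : Fin 3 → Bool, orbitDist (TT.twist3 z U) < δ β) →
        (∀ a : Fin (k + 1) → ℝ, a ≠ 0 → 0 < l2 (fun U => ∑ i, a i * F i U) (fun U => ∑ i, a i * F i U)) →
          ∃ a : Fin (k + 1) → ℝ, a ≠ 0 ∧
            qform su2Rep β (fun U => ∑ i, a i * F i U) (fun U => ∑ i, a i * F i U) * levelValue su2Rep 1 ((L : ℝ) ^ 3 * β) 0 ≤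
              Real.exp (C * bareLambda ((L : ℝ) ^ 3 * β) ^ 2) * levelValue su2Rep 1 ((L : ℝ) ^ 3 * β) k *
                levelValue su2Rep L β 0 * l2 (fun U => ∑ i, a i * F i U) (fun U => ∑ i, a i * F i U) :=
  innerRate_of_oneOrbitRate k hδ hδL (oneOrbitRate_of_softTubeRateOn hT (softTubeNoIntruderRateOn_of_ratePackage hP) k)

/-- `β^{−1/40} ≤ 1/(2L)` eventually. [folklore] -/
theorem powScale_fortieth_eventually_le : ∃ β1 : ℝ, ∀ β : ℝ, β1 ≤ β → powScale (1 / 40) β ≤ 1 / (2 * L) := by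
  have hL : (0 : ℝ) < L := by exact_mod_cast Nat.pos_of_ne_zero (NeZero.ne L)
  exact powScale_eventually_le (by norm_num) (by positivity)

/-- ★★★★ **K1 `NearFlatRatioLaw` ⇐ the rate-grade tube package at the inner scale `β^{−1/40}` on every `L ≥ 2`** (admissible weights `χ L`, test support
`{orbitDist < β^{−1/40}}`): the chain of this file at `k = 1`, then `nearFlatRatioLaw_of_innerRate` (p626045). [cite: Luscher1983, §3] [cite: GustafsonSigal2003, §11–§12] -/
theorem nearFlatRatioLaw_of_ratePackage {χ : (L : ℕ) → ℝ → GaugeConfig 3 L SU2 → ℝ}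
    (h : ∀ (L : ℕ) [NeZero L], 2 ≤ L →
      SoftTubeAdmissible L (powScale (1 / 40)) (χ L) ∧ SoftTubeBORatePackageOn L (χ L) (fun β => {U | orbitDist U < powScale (1 / 40) β})) :
    Summit.QuantumFields.YangMills.Theses.FlatTubeReduction.NearFlatRatioLaw :=
  Summit.QuantumFields.YangMills.Theorems.FlatTubeReduction.nearFlatRatioLaw_of_innerRate fun L _ hL =>
    innerRateAt_of_ratePackage (L := L) 1 (fun β => powScale_pos (1 / 40) β) powScale_fortieth_eventually_le (h L hL).1 (h L hL).2

/-- ★★★★ **FCL 23943 `FixedLatticeLaw` ≡ `FemtoGapFixedLattice` ⇐ the same rate-grade tube package on every `L ≥ 2`** (`L = 1` is crux ONE): the chain at `k = 1`,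
the RED fleet's valley gain `valleyGainAt_ledger`, and FCL's `femtoGapFixedLatticeAt_of_valley_innerRate`. [cite: Luscher1983, §3] [cite: LuscherMunster1984, §2] -/
theorem femtoGapFixedLattice_of_ratePackage {χ : (L : ℕ) → ℝ → GaugeConfig 3 L SU2 → ℝ}
    (h : ∀ (L : ℕ) [NeZero L], 2 ≤ L →
      SoftTubeAdmissible L (powScale (1 / 40)) (χ L) ∧ SoftTubeBORatePackageOn L (χ L) (fun β => {U | orbitDist U < powScale (1 / 40) β})) :
    FemtoGapFixedLattice := by
  intro L _
  by_cases hL : 2 ≤ L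
  · exact femtoGapFixedLatticeAt_of_valley_innerRate (L := L) (p := 1 / 40) (q := 17 / 20) (by norm_num) (by norm_num) (by norm_num)
      (valleyGainAt_ledger hL)
      (innerRateAt_of_ratePackage (L := L) 1 (fun β => powScale_pos (1 / 40) β) powScale_fortieth_eventually_le (h L hL).1 (h L hL).2)
  · have hL1 : L = 1 := by
      have h0 : L ≠ 0 := NeZero.ne L
      omega
    subst hL1
    exact femtoGapOneSite_proof

/-- ★★★★ **K1 ⇐ the rate-grade package for the BIG RECORD WEIGHT** `χ_big = recordWeightRho (3β^{−1/40}) (Mβ^{−1/40}) δg` (`M ≥ 6`, gauge width `δg` free), test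
functions in the small core `{orbitDist < β^{−1/40}}` — the rate twin of lane A's instance of record `innerNoIntruderOneOrbitAt_pow_of_bigRecordWeight_packageOn`.
[cite: Luscher1983, §3] -/
theorem nearFlatRatioLaw_of_bigRecordWeight_ratePackage (M : ℝ) (hM : 6 ≤ M) {δg : ℕ → ℝ → ℝ}
    (h : ∀ (L : ℕ) [NeZero L], 2 ≤ L →
      SoftTubeBORatePackageOn L (recordWeightRho L (fun β => 3 * powScale (1 / 40) β) (fun β => M * powScale (1 / 40) β) (δg L))
        (fun β => {U | orbitDist U < powScale (1 / 40) β})) :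
    Summit.QuantumFields.YangMills.Theses.FlatTubeReduction.NearFlatRatioLaw :=
  Summit.QuantumFields.YangMills.Theorems.FlatTubeReduction.nearFlatRatioLaw_of_innerRate fun L _ hL =>
    innerRateAt_of_ratePackage (L := L) 1 (fun β => powScale_pos (1 / 40) β) powScale_fortieth_eventually_le
      (softTubeAdmissible_mono (fun β => by linarith [powScale_pos (1 / 40) β])
        (softTubeAdmissible_recordWeightRho L (δ := fun β => 3 * powScale (1 / 40) β) (ρ := fun β => M * powScale (1 / 40) β) (δg := δg L)
          (fun β => by linarith [powScale_pos (1 / 40) β]) (fun β => by nlinarith [powScale_pos (1 / 40) β])))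
      (h L hL)

/-- ★★★★ **FCL 23943 ⇐ the rate-grade package for the big record weight**, likewise. [cite: Luscher1983, §3] -/
theorem femtoGapFixedLattice_of_bigRecordWeight_ratePackage (M : ℝ) (hM : 6 ≤ M) {δg : ℕ → ℝ → ℝ}
    (h : ∀ (L : ℕ) [NeZero L], 2 ≤ L →
      SoftTubeBORatePackageOn L (recordWeightRho L (fun β => 3 * powScale (1 / 40) β) (fun β => M * powScale (1 / 40) β) (δg L))
        (fun β => {U | orbitDist U < powScale (1 / 40) β})) :
    FemtoGapFixedLattice := by
  intro L _
  by_cases hL : 2 ≤ L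
  · exact femtoGapFixedLatticeAt_of_valley_innerRate (L := L) (p := 1 / 40) (q := 17 / 20) (by norm_num) (by norm_num) (by norm_num)
      (valleyGainAt_ledger hL)
      (innerRateAt_of_ratePackage (L := L) 1 (fun β => powScale_pos (1 / 40) β) powScale_fortieth_eventually_le
        (softTubeAdmissible_mono (fun β => by linarith [powScale_pos (1 / 40) β])
          (softTubeAdmissible_recordWeightRho L (δ := fun β => 3 * powScale (1 / 40) β) (ρ := fun β => M * powScale (1 / 40) β) (δg := δg L)
            (fun β => by linarith [powScale_pos (1 / 40) β]) (fun β => by nlinarith [powScale_pos (1 / 40) β])))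
        (h L hL))
  · have hL1 : L = 1 := by
      have h0 : L ≠ 0 := NeZero.ne L
      omega
    subst hL1
    exact femtoGapOneSite_proof

end RateTube

end Summit.QuantumFields.YangMills.Theorems.FemtoTransferGap

end
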